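import Literature.AlgebraicGeometry.AbelianSchemes.AbelianSchemeBaseChangeComp
import Literature.AlgebraicGeometry.AbelianVarieties.MumfordSheafLinearisation
import Literature.AlgebraicGeometry.Motives.AbelianVarietyCubeBilinear
import HarnessLib

/-!
# The unit section of `A × T → T` as a whiskered unit point, and the zero slice

Layer `Literature/AlgebraicGeometry/AbelianVarieties`, namespace `Literature.AlgebraicGeometry.AbelianVarieties`. THEOREMS
ONLY; no named fact, no instance, no notation. Cell `hodgecm-mathlib` (D-0151), M1PRIME-DAG rung 0, J0b road (i) glue (s-ii)
for the (R3a) assembly «`universal` on normal `T`» (B-p02 lineage): the two spellings of the section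
`(ε_A, id) : T → A × T` that the D2 currency (`AbelianSchemeOver.baseChange`, `unitSection`, [MumfordFogartyKirwan1994,
Ch. 6 §1–2]) and the cartesian-monoidal `SchemeOver K` currency (`(λ_T)⁻¹ ≫ x₀ ▷ T` with `x₀ = unitPoint 1 : 𝟙 ⟶ A` the origin,
★ `Motives/AbelianVarietyCubeBilinear`) give, for an abelian variety `A₀` over a field `K` and `T : SchemeOver K`:

* `leftUnitor_inv_comp_unitPoint_one_whiskerRight` — `(λ_T)⁻¹ ≫ (unitPoint 1) ▷ T = lift 1 (𝟙 T)` (normal form);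
* **`unitSection_baseChange_ofAbelianVariety`** — `((ofAbelianVariety A₀).baseChange T.hom).unitSection =
  ((λ_T)⁻¹ ≫ (A₀.unitPoint 1) ▷ T).left` as morphisms `T → A₀ ×_K T` (the base-changed identity section IS the
  whiskered origin; [GortzWedhorn2020, Remark 16.54]);
* **`leftUnitor_inv_comp_unitPoint_one_whiskerRight_comp_whiskerLeft`** — `((λ_T)⁻¹ ≫ x₀ ▷ T) ≫ A₀ ◁ ψ = ψ ≫ sliceZero A₀ B₀`
  for `ψ : T ⟶ B₀` (★ `sliceZero A₀ B₀ = lift 1 (𝟙 _)` of `MumfordSheafLinearisation`): restricting along the unit section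
  and then along `1 × ψ` is restricting along `ψ` and then along the zero slice `{0} × B₀`.

Banked capital; HC_CM is proved only modulo the 7 printed citations until rung 0 closes.

## References

* [MumfordFogartyKirwan1994] D. Mumford, J. Fogarty, F. Kirwan, *Geometric Invariant Theory* (3rd ed.), Ch. 6 §1 Def. 6.1
  (p. 115) and §2 (p. 121) (identity section; normalisation along `ε × 1`).
* [GortzWedhorn2020] U. Görtz, T. Wedhorn, *Algebraic Geometry I* (2nd ed.), Section (4.7) (p. 135), Remark 16.54 (p. 678).
* [MumfordAV1970] D. Mumford, *Abelian Varieties* (1970), §13 (p. 125) (restriction of the Poincaré sheaf to `{0} × Â`).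
-/

noncomputable section

open CategoryTheory CategoryTheory.Limits AlgebraicGeometry MonoidalCategory CartesianMonoidalCategory
open Literature.AlgebraicGeometry.Motives Literature.AlgebraicGeometry.AbelianSchemes
open scoped MonObj

universe u

namespace Literature.AlgebraicGeometry.AbelianVarieties

variable {K : Type u} [Field K] (A₀ : AbelianVariety K) (T : SchemeOver K)

/-- **Normal form of the whiskered origin**: `(λ_T)⁻¹ ≫ (unitPoint 1) ▷ T = (1, 𝟙_T) : T ⟶ A₀ × T`.
[cite: MumfordFogartyKirwan1994, Ch. 6 §1 Definition 6.1 (p. 115)] -/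
theorem leftUnitor_inv_comp_unitPoint_one_whiskerRight :
    (λ_ T).inv ≫ A₀.unitPoint 1 ▷ T = lift (1 : T ⟶ A₀.X) (𝟙 T) := by
  refine CartesianMonoidalCategory.hom_ext _ _ ?_ ?_
  · rw [Category.assoc, whiskerRight_fst, leftUnitor_inv_fst_assoc, lift_fst, AbelianVariety.toUnit_comp_unitPoint,
      MonObj.comp_one]
  · rw [Category.assoc, whiskerRight_snd, leftUnitor_inv_snd, lift_snd]

/-- The underlying scheme morphism of `(1, 𝟙_T) : T ⟶ A₀ × T` followed by the first projection is the constant map to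
the origin, `T.hom ≫ ε_{A₀}`. [cite: MumfordFogartyKirwan1994, Ch. 6 §1 Definition 6.1 (p. 115)] -/
theorem lift_one_id_left_comp_pullback_fst :
    (lift (1 : T ⟶ A₀.X) (𝟙 T)).left ≫ pullback.fst A₀.X.hom T.hom = T.hom ≫ η[A₀.X].left := by
  have h : (lift (1 : T ⟶ A₀.X) (𝟙 T)).left ≫ pullback.fst A₀.X.hom T.hom =
      (lift (1 : T ⟶ A₀.X) (𝟙 T) ≫ fst A₀.X T).left := rfl
  rw [h, lift_fst]
  rfl

/-- … and followed by the second projection it is the identity. [cite: MumfordFogartyKirwan1994, Ch. 6 §1 (p. 115)] -/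
theorem lift_one_id_left_comp_pullback_snd :
    (lift (1 : T ⟶ A₀.X) (𝟙 T)).left ≫ pullback.snd A₀.X.hom T.hom = 𝟙 T.left := by
  have h : (lift (1 : T ⟶ A₀.X) (𝟙 T)).left ≫ pullback.snd A₀.X.hom T.hom =
      (lift (1 : T ⟶ A₀.X) (𝟙 T) ≫ snd A₀.X T).left := rfl
  rw [h, lift_snd, Over.id_left]

/-- **The base-changed identity section is the whiskered origin**: for an abelian variety `A₀` over `K` and a
`K`-scheme `T`, the identity section `ε : T → A₀ ×_K T` of the abelian scheme `(ofAbelianVariety A₀) ×_{Spec K} T`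
(D2 currency, the transported group structure) is the underlying morphism of `(λ_T)⁻¹ ≫ (unitPoint 1) ▷ T : T ⟶ A₀ ⊗ T`
(cartesian-monoidal `SchemeOver K` currency; the two targets `pullback A₀.X.hom T.hom` agree definitionally).
[cite: GortzWedhorn2020, Remark 16.54 (p. 678)] [cite: MumfordFogartyKirwan1994, Ch. 6 §1 Definition 6.1 (p. 115)] -/
theorem unitSection_baseChange_ofAbelianVariety :
    ((AbelianSchemeOver.ofAbelianVariety A₀).baseChange T.hom).unitSection =
      ((λ_ T).inv ≫ A₀.unitPoint 1 ▷ T).left := by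
  rw [leftUnitor_inv_comp_unitPoint_one_whiskerRight]
  apply pullback.hom_ext
  · exact ((AbelianSchemeOver.ofAbelianVariety A₀).unitSection_baseChange_comp_fst T.hom).trans
      (lift_one_id_left_comp_pullback_fst A₀ T).symm
  · exact ((AbelianSchemeOver.ofAbelianVariety A₀).baseChange T.hom).unitSection_comp_hom.trans
      (lift_one_id_left_comp_pullback_snd A₀ T).symm

variable {T} (B₀ : AbelianVariety K)

/-- **Unit section, then `1 × ψ` = `ψ`, then the zero slice**: `((λ_T)⁻¹ ≫ x₀ ▷ T) ≫ A₀ ◁ ψ = ψ ≫ sliceZero A₀ B₀` for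
`x₀ = unitPoint 1` the origin and any `ψ : T ⟶ B₀` (both are `t ↦ (0, ψ t)`); so `((1 × ψ)^*𝒫)|_{ε × T} = ψ^*(𝒫|_{{0} × B₀})`,
the step that turns the normalisation of the Poincaré sheaf along `{0} × Â` into the rigidification of every
`(1 × ψ)^*𝒫`. [cite: MumfordAV1970, §13 (p. 125)] [cite: MumfordFogartyKirwan1994, Ch. 6 §2 (p. 121)] -/
theorem leftUnitor_inv_comp_unitPoint_one_whiskerRight_comp_whiskerLeft (ψ : T ⟶ B₀.X) :
    ((λ_ T).inv ≫ A₀.unitPoint 1 ▷ T) ≫ A₀.X ◁ ψ = ψ ≫ sliceZero A₀ B₀ := by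
  rw [leftUnitor_inv_comp_unitPoint_one_whiskerRight]
  refine CartesianMonoidalCategory.hom_ext _ _ ?_ ?_
  · rw [Category.assoc, whiskerLeft_fst, lift_fst, Category.assoc, sliceZero_fst, MonObj.comp_one]
  · rw [Category.assoc, whiskerLeft_snd, lift_snd_assoc, Category.id_comp, Category.assoc, sliceZero_snd,
      Category.comp_id]

/-- The same on underlying scheme morphisms (the form module pull-backs are taken along).
[cite: MumfordAV1970, §13 (p. 125)] -/
theorem leftUnitor_inv_comp_unitPoint_one_whiskerRight_comp_whiskerLeft_left (ψ : T ⟶ B₀.X) :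
    ((λ_ T).inv ≫ A₀.unitPoint 1 ▷ T).left ≫ (A₀.X ◁ ψ).left = ψ.left ≫ (sliceZero A₀ B₀).left := by
  rw [← Over.comp_left, ← Over.comp_left, leftUnitor_inv_comp_unitPoint_one_whiskerRight_comp_whiskerLeft]

/-- Hence also with the D2 unit section: `ε_{A₀ × T} ≫ (1 × ψ) = ψ ≫ sliceZero A₀ B₀` on underlying schemes.
[cite: MumfordAV1970, §13 (p. 125)] [cite: MumfordFogartyKirwan1994, Ch. 6 §2 (p. 121)] -/
theorem unitSection_baseChange_comp_whiskerLeft_left (ψ : T ⟶ B₀.X) :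
    ((AbelianSchemeOver.ofAbelianVariety A₀).baseChange T.hom).unitSection ≫ (A₀.X ◁ ψ).left =
      ψ.left ≫ (sliceZero A₀ B₀).left := by
  rw [unitSection_baseChange_ofAbelianVariety]
  exact leftUnitor_inv_comp_unitPoint_one_whiskerRight_comp_whiskerLeft_left A₀ B₀ ψ

end Literature.AlgebraicGeometry.AbelianVarieties

end
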